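import Mathlib
import HarnessLib
import Literature.MathematicalPhysics.KineticTheory.LangevinChainGibbs
import Summits.AtomisticToContinuum.FouriersLaw.Theorems.JunctionLocalityInsertionCalculus

/-!
# Insertion identity toolbox, Ib: energy cutoffs for the pinned chain

Support file for stub `stub_insertionIdentity` (line `thermalise-then-cut-probe-insertion`, crux
`stmt-AtomisticToContinuum-11748`). The cutoffs `χ_n = sT(2 − H/(n+1))` (`sT` = Mathlib's
`Real.smoothTransition`): smooth, compactly supported (sublevel sets of the pinned energy are
compact), `0 ≤ χ_n ≤ 1`, `χ_n → 1`, killed by the Liouville operator, with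
`|∂_{p_i}χ_n| ≤ C/√(n+1)` and `|S_i χ_n| ≤ C` uniformly, all cutoff derivatives eventually
vanishing at each point. All [folklore]. No definitions.
-/

noncomputable section

open scoped ContDiff Topology ENNReal NNReal Convolution Pointwise
open MeasureTheory ProbabilityTheory Filter Set Function
open Literature.MathematicalPhysics.KineticTheory.HeatConduction

namespace Summit.AtomisticToContinuum.FouriersLaw.Cruxes.SuperadditiveResistance.InsertionToolbox

local notation "uP" i' => ((0, Pi.single i' 1) : PhaseSpace _)
local notation "uQ" i' => ((Pi.single i' 1, 0) : PhaseSpace _)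

local notation "OU⟦" T' ";" i' ";" f' ";" x' "⟧" =>
  T' * partialP i' (partialP i' f') x' - Prod.snd (x' : PhaseSpace _) i' * partialP i' f' x'
local notation "XH⟦" P' ";" f' ";" x' "⟧" =>
  ∑ i, (Prod.snd (x' : PhaseSpace _) i * partialQ i f' x' -
    partialQ i (OscillatorChain.hamiltonian P' _) x' * partialP i f' x')
local notation "GEN⟦" P' ";" T' ";" c' ";" f' ";" x' "⟧" =>
  XH⟦P' ; f' ; x'⟧ + ∑ i, c' i * OU⟦T' ; i ; f' ; x'⟧
local notation "CUT⟦" ω₂' ";" lam' ";" β' ";" γ' ";" n' ";" x' "⟧" =>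
  Real.smoothTransition (2 - OscillatorChain.hamiltonian (pinnedChain ω₂' lam' β' γ') _ x' / ((n' : ℝ) + 1))

variable {L : ℕ}

/-! ### Energy cutoffs `χ_n = sT(2 − H/(n+1))` for the pinned chain -/

section Cutoff

variable {ω₂ lam β : ℝ}

/-- The Hamiltonian of the pinned chain is smooth. [folklore] -/
theorem pinnedChain_contDiff_hamiltonian (ω₂ lam β γ : ℝ) (L : ℕ) {n : WithTop ℕ∞} :
    ContDiff ℝ n ((pinnedChain ω₂ lam β γ).hamiltonian L) :=
  (pinnedChain ω₂ lam β γ).contDiff_hamiltonian (pinnedChain_contDiff_U ω₂ lam β γ)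
    (pinnedChain_contDiff_V ω₂ lam β γ) L

/-- A single kinetic term is bounded by the energy: `p_i²/2 ≤ H`. [folklore] -/
theorem pinnedChain_sq_le_hamiltonian (hω : 0 ≤ ω₂) (hl : 0 ≤ lam) (hβ : 0 ≤ β) (γ : ℝ)
    (L : ℕ) (x : PhaseSpace L) (i : Fin L) :
    x.2 i ^ 2 / 2 ≤ (pinnedChain ω₂ lam β γ).hamiltonian L x := by
  have h := pinnedChain_harmonic_le_hamiltonian (ω₂ := ω₂) hl hβ γ L x
  have h1 : x.2 i ^ 2 / 2 ≤ ∑ k, x.2 k ^ 2 / 2 :=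
    Finset.single_le_sum (f := fun k => x.2 k ^ 2 / 2) (fun k _ => by positivity)
      (Finset.mem_univ i)
  have h2 : 0 ≤ ∑ k, ω₂ * x.1 k ^ 2 / 2 := Finset.sum_nonneg fun k _ => by positivity
  linarith

/-- A single pinning term is bounded by the energy: `ω₂ q_i²/2 ≤ H`. [folklore] -/
theorem pinnedChain_q_sq_le_hamiltonian (hω : 0 ≤ ω₂) (hl : 0 ≤ lam) (hβ : 0 ≤ β) (γ : ℝ)
    (L : ℕ) (x : PhaseSpace L) (i : Fin L) :
    ω₂ * x.1 i ^ 2 / 2 ≤ (pinnedChain ω₂ lam β γ).hamiltonian L x := by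
  have h := pinnedChain_harmonic_le_hamiltonian (ω₂ := ω₂) hl hβ γ L x
  have h1 : ω₂ * x.1 i ^ 2 / 2 ≤ ∑ k, ω₂ * x.1 k ^ 2 / 2 :=
    Finset.single_le_sum (f := fun k => ω₂ * x.1 k ^ 2 / 2) (fun k _ => by positivity)
      (Finset.mem_univ i)
  have h2 : 0 ≤ ∑ k, x.2 k ^ 2 / 2 := Finset.sum_nonneg fun k _ => by positivity
  linarith

/-- The energy is non-negative. [folklore] -/
theorem pinnedChain_hamiltonian_nonneg' (hω : 0 ≤ ω₂) (hl : 0 ≤ lam) (hβ : 0 ≤ β) (γ : ℝ)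
    (L : ℕ) (x : PhaseSpace L) : 0 ≤ (pinnedChain ω₂ lam β γ).hamiltonian L x := by
  have h := pinnedChain_harmonic_le_hamiltonian (ω₂ := ω₂) hl hβ γ L x
  have h1 : 0 ≤ ∑ k, ω₂ * x.1 k ^ 2 / 2 := Finset.sum_nonneg fun k _ => by positivity
  have h2 : 0 ≤ ∑ k, x.2 k ^ 2 / 2 := Finset.sum_nonneg fun k _ => by positivity
  linarith

/-- Sublevel sets of the energy of the pinned chain (`ω₂ > 0`) are compact. [folklore] -/
theorem pinnedChain_isCompact_hamiltonian_le (hω : 0 < ω₂) (hl : 0 ≤ lam) (hβ : 0 ≤ β) (γ : ℝ)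
    (L : ℕ) (c : ℝ) : IsCompact {x : PhaseSpace L | (pinnedChain ω₂ lam β γ).hamiltonian L x ≤ c} := by
  refine Metric.isCompact_of_isClosed_isBounded
    (isClosed_le (pinnedChain_continuous_hamiltonian ω₂ lam β γ L) continuous_const) ?_
  rw [Metric.isBounded_iff_subset_closedBall 0]
  refine ⟨Real.sqrt (2 * |c| / ω₂) + Real.sqrt (2 * |c|), fun x hx => ?_⟩
  simp only [Set.mem_setOf_eq] at hx
  rw [Metric.mem_closedBall, dist_zero_right]
  have hc : (pinnedChain ω₂ lam β γ).hamiltonian L x ≤ |c| := hx.trans (le_abs_self c)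
  have hq : ‖x.1‖ ≤ Real.sqrt (2 * |c| / ω₂) := by
    refine (pi_norm_le_iff_of_nonneg (Real.sqrt_nonneg _)).mpr fun i => ?_
    rw [Real.norm_eq_abs, ← Real.sqrt_sq_eq_abs]
    refine Real.sqrt_le_sqrt ?_
    rw [le_div_iff₀ hω]
    have := pinnedChain_q_sq_le_hamiltonian hω.le hl hβ γ L x i
    nlinarith
  have hp : ‖x.2‖ ≤ Real.sqrt (2 * |c|) := by
    refine (pi_norm_le_iff_of_nonneg (Real.sqrt_nonneg _)).mpr fun i => ?_
    rw [Real.norm_eq_abs, ← Real.sqrt_sq_eq_abs]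
    refine Real.sqrt_le_sqrt ?_
    have := pinnedChain_sq_le_hamiltonian hω.le hl hβ γ L x i
    nlinarith
  calc ‖x‖ = max ‖x.1‖ ‖x.2‖ := rfl
    _ ≤ Real.sqrt (2 * |c| / ω₂) + Real.sqrt (2 * |c|) :=
        max_le (hq.trans (le_add_of_nonneg_right (Real.sqrt_nonneg _)))
          (hp.trans (le_add_of_nonneg_left (Real.sqrt_nonneg _)))

/-- The energy cutoff is smooth. [folklore] -/
theorem contDiff_cutoff (ω₂ lam β γ : ℝ) (L : ℕ) (n : ℕ) :
    ContDiff ℝ ∞ fun x : PhaseSpace L => CUT⟦ω₂ ; lam ; β ; γ ; n ; x⟧ :=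
  contDiff_smoothTransition_infty.comp
    (contDiff_const.sub ((pinnedChain_contDiff_hamiltonian ω₂ lam β γ L).div_const _))

/-- The energy cutoff is `C^k` for every finite `k`. [folklore] -/
theorem contDiff_cutoff_nat (ω₂ lam β γ : ℝ) (L : ℕ) (n : ℕ) (k : ℕ) :
    ContDiff ℝ k fun x : PhaseSpace L => CUT⟦ω₂ ; lam ; β ; γ ; n ; x⟧ :=
  contDiff_infty.mp (contDiff_cutoff ω₂ lam β γ L n) k

/-- The energy cutoff has compact support (inside `{H ≤ 2(n+1)}`). [folklore] -/
theorem hasCompactSupport_cutoff (hω : 0 < ω₂) (hl : 0 ≤ lam) (hβ : 0 ≤ β) (γ : ℝ) (L : ℕ)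
    (n : ℕ) : HasCompactSupport fun x : PhaseSpace L => CUT⟦ω₂ ; lam ; β ; γ ; n ; x⟧ := by
  refine HasCompactSupport.intro
    (pinnedChain_isCompact_hamiltonian_le hω hl hβ γ L (2 * ((n : ℝ) + 1))) fun x hx => ?_
  simp only [Set.mem_setOf_eq, not_le] at hx
  apply Real.smoothTransition.zero_of_nonpos
  have hn : (0 : ℝ) < (n : ℝ) + 1 := by positivity
  rw [sub_nonpos, le_div_iff₀ hn]
  linarith

/-- `0 ≤ χ_n ≤ 1`. [folklore] -/
theorem cutoff_mem_Icc (ω₂ lam β γ : ℝ) (L : ℕ) (n : ℕ) (x : PhaseSpace L) :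
    CUT⟦ω₂ ; lam ; β ; γ ; n ; x⟧ ∈ Set.Icc (0 : ℝ) 1 :=
  ⟨Real.smoothTransition.nonneg _, Real.smoothTransition.le_one _⟩

/-- `χ_n = 1` on `{H ≤ n + 1}`. [folklore] -/
theorem cutoff_eq_one {ω₂ lam β : ℝ} (γ : ℝ) {L : ℕ} {n : ℕ} {x : PhaseSpace L}
    (hx : (pinnedChain ω₂ lam β γ).hamiltonian L x ≤ (n : ℝ) + 1) :
    CUT⟦ω₂ ; lam ; β ; γ ; n ; x⟧ = 1 := by
  apply Real.smoothTransition.one_of_one_le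
  have hn : (0 : ℝ) < (n : ℝ) + 1 := by positivity
  have : (pinnedChain ω₂ lam β γ).hamiltonian L x / ((n : ℝ) + 1) ≤ 1 := by
    rw [div_le_one hn]; exact hx
  linarith

/-- Eventually (in `n`) `χ_n(x) = 1`, for every fixed `x`. [folklore] -/
theorem eventually_cutoff_eq_one (ω₂ lam β γ : ℝ) (L : ℕ) (x : PhaseSpace L) :
    ∀ᶠ k : ℕ in atTop, CUT⟦ω₂ ; lam ; β ; γ ; k ; x⟧ = 1 := by
  obtain ⟨N, hN⟩ := exists_nat_ge ((pinnedChain ω₂ lam β γ).hamiltonian L x)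
  filter_upwards [eventually_ge_atTop N] with n hn
  apply cutoff_eq_one
  have : (N : ℝ) ≤ n := by exact_mod_cast hn
  linarith

set_option linter.unusedVariables false in
/-- `χ_n → 1` pointwise. [folklore] -/
theorem tendsto_cutoff (ω₂ lam β γ : ℝ) (L : ℕ) (x : PhaseSpace L) :
    Tendsto (fun n : ℕ => CUT⟦ω₂ ; lam ; β ; γ ; n ; x⟧) atTop (𝓝 1) :=
  tendsto_const_nhds.congr' ((eventually_cutoff_eq_one ω₂ lam β γ L x).mono fun n hn => hn.symm)

/-! #### Derivatives of the cutoff -/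

/-- The profile `t ↦ sT(2 − t/(n+1))` and its derivative. [folklore] -/
theorem hasDerivAt_cutProfile (n : ℕ) (t : ℝ) :
    HasDerivAt (fun t : ℝ => Real.smoothTransition (2 - t / ((n : ℝ) + 1)))
      (-(deriv Real.smoothTransition (2 - t / ((n : ℝ) + 1))) / ((n : ℝ) + 1)) t := by
  have hd : Differentiable ℝ Real.smoothTransition :=
    contDiff_smoothTransition_infty.differentiable (by simp)
  have hin : HasDerivAt (fun t : ℝ => 2 - t / ((n : ℝ) + 1)) (-(1 / ((n : ℝ) + 1))) t := by
    have := ((hasDerivAt_id t).div_const ((n : ℝ) + 1)).const_sub 2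
    simpa using this
  have h := ((hd _).hasDerivAt).comp t hin
  refine h.congr_deriv ?_
  ring

/-- `d/dt sT(2 − t/(n+1)) = −sT'(2 − t/(n+1))/(n+1)`. [folklore] -/
theorem deriv_cutProfile (n : ℕ) :
    deriv (fun t : ℝ => Real.smoothTransition (2 - t / ((n : ℝ) + 1))) =
      fun t => -(deriv Real.smoothTransition (2 - t / ((n : ℝ) + 1))) / ((n : ℝ) + 1) :=
  funext fun t => (hasDerivAt_cutProfile n t).deriv

/-- `d²/dt² sT(2 − t/(n+1)) = sT''(2 − t/(n+1))/(n+1)²`. [folklore] -/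
theorem deriv_deriv_cutProfile (n : ℕ) (t : ℝ) :
    deriv (deriv (fun t : ℝ => Real.smoothTransition (2 - t / ((n : ℝ) + 1)))) t =
      deriv (deriv Real.smoothTransition) (2 - t / ((n : ℝ) + 1)) / ((n : ℝ) + 1) ^ 2 := by
  rw [deriv_cutProfile]
  have hd : Differentiable ℝ (deriv Real.smoothTransition) := by
    have := (Real.smoothTransition.contDiff (n := 2)).iterate_deriv' 1 1
    simpa using this.differentiable (by simp)
  have hin : HasDerivAt (fun t : ℝ => 2 - t / ((n : ℝ) + 1)) (-(1 / ((n : ℝ) + 1))) t := by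
    have := ((hasDerivAt_id t).div_const ((n : ℝ) + 1)).const_sub 2
    simpa using this
  have h := (((hd _).hasDerivAt).comp t hin).neg.div_const ((n : ℝ) + 1)
  have h' : HasDerivAt (fun t => -(deriv Real.smoothTransition (2 - t / ((n : ℝ) + 1))) /
      ((n : ℝ) + 1)) (deriv (deriv Real.smoothTransition) (2 - t / ((n : ℝ) + 1)) /
        ((n : ℝ) + 1) ^ 2) t := by
    refine h.congr_deriv ?_
    field_simp
  exact h'.deriv

/-- The profile is `C²`. [folklore] -/
theorem contDiff_cutProfile (n : ℕ) :
    ContDiff ℝ 2 fun t : ℝ => Real.smoothTransition (2 - t / ((n : ℝ) + 1)) :=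
  (Real.smoothTransition.contDiff (n := 2)).comp
    (contDiff_const.sub (contDiff_id.div_const _))

/-- `∂_{p_i} χ_n = −sT'(2 − H/(n+1)) p_i/(n+1)`. [folklore] -/
theorem partialP_cutoff (ω₂ lam β γ : ℝ) (L : ℕ) (n : ℕ) (i : Fin L) (x : PhaseSpace L) :
    partialP i (fun y : PhaseSpace L => CUT⟦ω₂ ; lam ; β ; γ ; n ; y⟧) x =
      -(deriv Real.smoothTransition
        (2 - (pinnedChain ω₂ lam β γ).hamiltonian L x / ((n : ℝ) + 1))) / ((n : ℝ) + 1) *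
        x.2 i := by
  rw [partialP_comp (φ := fun t : ℝ => Real.smoothTransition (2 - t / ((n : ℝ) + 1)))
    ((contDiff_cutProfile n).differentiable two_ne_zero)
    ((pinnedChain_contDiff_hamiltonian ω₂ lam β γ L (n := 1)).differentiable one_ne_zero),
    deriv_cutProfile, OscillatorChain.partialP_hamiltonian]

/-- The Liouville operator kills the energy cutoff: `X_H χ_n = 0`. [folklore] -/
theorem liouville_cutoff (ω₂ lam β γ : ℝ) (L : ℕ) (n : ℕ) (x : PhaseSpace L) :
    XH⟦pinnedChain ω₂ lam β γ ; fun y : PhaseSpace L => CUT⟦ω₂ ; lam ; β ; γ ; n ; y⟧ ; x⟧ = 0 := by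
  rw [liouville_comp (pinnedChain ω₂ lam β γ)
    (φ := fun t : ℝ => Real.smoothTransition (2 - t / ((n : ℝ) + 1)))
    ((contDiff_cutProfile n).differentiable two_ne_zero)
    ((pinnedChain_contDiff_hamiltonian ω₂ lam β γ L (n := 1)).differentiable one_ne_zero),
    liouville_hamiltonian, mul_zero]

/-- The thermostat of the energy cutoff:
`S_i χ_n = −sT'(·)(T − p_i²)/(n+1) + T sT''(·) p_i²/(n+1)²`. [folklore] -/
theorem ou_cutoff (ω₂ lam β γ : ℝ) (L : ℕ) (T : ℝ) (n : ℕ) (i : Fin L) (x : PhaseSpace L) :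
    OU⟦T ; i ; fun y : PhaseSpace L => CUT⟦ω₂ ; lam ; β ; γ ; n ; y⟧ ; x⟧ =
      -(deriv Real.smoothTransition
          (2 - (pinnedChain ω₂ lam β γ).hamiltonian L x / ((n : ℝ) + 1))) / ((n : ℝ) + 1) *
          (T - x.2 i ^ 2) +
        T * (deriv (deriv Real.smoothTransition)
          (2 - (pinnedChain ω₂ lam β γ).hamiltonian L x / ((n : ℝ) + 1)) / ((n : ℝ) + 1) ^ 2) *
          x.2 i ^ 2 := by
  rw [ou_comp (φ := fun t : ℝ => Real.smoothTransition (2 - t / ((n : ℝ) + 1)))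
    (contDiff_cutProfile n) (pinnedChain_contDiff_hamiltonian ω₂ lam β γ L (n := 2)),
    ou_hamiltonian, deriv_deriv_cutProfile, deriv_cutProfile, OscillatorChain.partialP_hamiltonian]

/-- On the support of `sT'(2 − H/(n+1))`, `n + 1 ≤ H ≤ 2(n+1)`; in particular `p_i² ≤ 4(n+1)`.
[folklore] -/
theorem sq_le_of_deriv_ne_zero (hω : 0 ≤ ω₂) (hl : 0 ≤ lam) (hβ : 0 ≤ β) (γ : ℝ) {L : ℕ}
    {n : ℕ} {x : PhaseSpace L}
    (h : deriv Real.smoothTransition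
        (2 - (pinnedChain ω₂ lam β γ).hamiltonian L x / ((n : ℝ) + 1)) ≠ 0 ∨
      deriv (deriv Real.smoothTransition)
        (2 - (pinnedChain ω₂ lam β γ).hamiltonian L x / ((n : ℝ) + 1)) ≠ 0) (i : Fin L) :
    x.2 i ^ 2 ≤ 4 * ((n : ℝ) + 1) := by
  have hn : (0 : ℝ) < (n : ℝ) + 1 := by positivity
  have key : ¬ (2 - (pinnedChain ω₂ lam β γ).hamiltonian L x / ((n : ℝ) + 1) < 0 ∨
      1 < 2 - (pinnedChain ω₂ lam β γ).hamiltonian L x / ((n : ℝ) + 1)) := by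
    intro hc
    rcases h with h | h
    · exact h (deriv_smoothTransition_eq_zero hc)
    · exact h (deriv_deriv_smoothTransition_eq_zero hc)
  simp only [not_or, not_lt] at key
  have hH : (pinnedChain ω₂ lam β γ).hamiltonian L x ≤ 2 * ((n : ℝ) + 1) := by
    have := key.1
    rw [sub_nonneg, div_le_iff₀ hn] at this
    linarith
  have := pinnedChain_sq_le_hamiltonian hω hl hβ γ L x i
  linarith

/-- **Uniform bounds on the cutoff derivatives**: `|∂_{p_i}χ_n| ≤ C/√(n+1)` and `|S_i χ_n| ≤ C`
with `C` independent of `n`, `i`, `x`. [folklore] -/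
theorem exists_cutoff_bounds (hω : 0 ≤ ω₂) (hl : 0 ≤ lam) (hβ : 0 ≤ β) (γ : ℝ) (L : ℕ) (T : ℝ) :
    ∃ C : ℝ, 0 ≤ C ∧ ∀ (n : ℕ) (i : Fin L) (x : PhaseSpace L),
      |partialP i (fun y : PhaseSpace L => CUT⟦ω₂ ; lam ; β ; γ ; n ; y⟧) x| ≤
          C / Real.sqrt ((n : ℝ) + 1) ∧
        |OU⟦T ; i ; fun y : PhaseSpace L => CUT⟦ω₂ ; lam ; β ; γ ; n ; y⟧ ; x⟧| ≤ C := by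
  obtain ⟨M, hM0, hM1, hM2⟩ := exists_bound_deriv_smoothTransition
  refine ⟨2 * M + 5 * M * |T| + 4 * M, by positivity, fun n i x => ?_⟩
  have hn : (0 : ℝ) < (n : ℝ) + 1 := by positivity
  have hsq : (0 : ℝ) < Real.sqrt ((n : ℝ) + 1) := Real.sqrt_pos.mpr hn
  have hsq2 : Real.sqrt ((n : ℝ) + 1) ^ 2 = (n : ℝ) + 1 := Real.sq_sqrt hn.le
  set s := 2 - (pinnedChain ω₂ lam β γ).hamiltonian L x / ((n : ℝ) + 1) with hs
  constructor
  · rw [partialP_cutoff]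
    by_cases hd : deriv Real.smoothTransition s = 0
    · rw [← hs, hd]
      simp only [neg_zero, zero_div, zero_mul, abs_zero]
      positivity
    · have hp : x.2 i ^ 2 ≤ 4 * ((n : ℝ) + 1) := sq_le_of_deriv_ne_zero hω hl hβ γ (Or.inl hd) i
      have habs : |x.2 i| ≤ 2 * Real.sqrt ((n : ℝ) + 1) := by
        rw [← Real.sqrt_sq_eq_abs, show (2 : ℝ) = Real.sqrt 4 by norm_num, ← Real.sqrt_mul (by norm_num)]
        exact Real.sqrt_le_sqrt hp
      rw [← hs, abs_mul, abs_div, abs_neg, abs_of_pos hn]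
      calc |deriv Real.smoothTransition s| / ((n : ℝ) + 1) * |x.2 i|
          ≤ M / ((n : ℝ) + 1) * (2 * Real.sqrt ((n : ℝ) + 1)) := by
            gcongr
            exact hM1 s
        _ = 2 * M * Real.sqrt ((n : ℝ) + 1) / Real.sqrt ((n : ℝ) + 1) ^ 2 := by
            rw [hsq2]; ring
        _ = 2 * M / Real.sqrt ((n : ℝ) + 1) := by
            rw [pow_two, mul_div_mul_right _ _ hsq.ne']
        _ ≤ (2 * M + 5 * M * |T| + 4 * M) / Real.sqrt ((n : ℝ) + 1) := by
            gcongr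
            nlinarith [abs_nonneg T]
  · rw [ou_cutoff]
    by_cases hd : deriv Real.smoothTransition s = 0 ∧ deriv (deriv Real.smoothTransition) s = 0
    · rw [← hs, hd.1, hd.2]
      simp only [neg_zero, zero_div, zero_mul, mul_zero, add_zero, abs_zero]
      positivity
    · have hd' : deriv Real.smoothTransition s ≠ 0 ∨ deriv (deriv Real.smoothTransition) s ≠ 0 := by
        tauto
      have hp : x.2 i ^ 2 ≤ 4 * ((n : ℝ) + 1) := sq_le_of_deriv_ne_zero hω hl hβ γ hd' i
      rw [← hs]
      have h1 : |-(deriv Real.smoothTransition s) / ((n : ℝ) + 1) * (T - x.2 i ^ 2)| ≤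
          M * |T| + 4 * M := by
        rw [abs_mul, abs_div, abs_neg, abs_of_pos hn]
        calc |deriv Real.smoothTransition s| / ((n : ℝ) + 1) * |T - x.2 i ^ 2|
            ≤ M / ((n : ℝ) + 1) * (|T| + 4 * ((n : ℝ) + 1)) := by
              gcongr
              · exact hM1 s
              · calc |T - x.2 i ^ 2| ≤ |T| + |x.2 i ^ 2| := abs_sub T (x.2 i ^ 2)
                  _ = |T| + x.2 i ^ 2 := by rw [abs_of_nonneg (sq_nonneg (x.2 i))]
                  _ ≤ |T| + 4 * ((n : ℝ) + 1) := by linarith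
          _ = M * |T| / ((n : ℝ) + 1) + 4 * M := by field_simp
          _ ≤ M * |T| + 4 * M := by
              gcongr
              exact div_le_self (by positivity) (by linarith)
      have h2 : |T * (deriv (deriv Real.smoothTransition) s / ((n : ℝ) + 1) ^ 2) * x.2 i ^ 2| ≤
          4 * M * |T| := by
        have hx2 : |x.2 i ^ 2| = x.2 i ^ 2 := abs_of_nonneg (sq_nonneg _)
        have hn2 : |((n : ℝ) + 1) ^ 2| = ((n : ℝ) + 1) ^ 2 := abs_of_pos (by positivity)
        rw [abs_mul, abs_mul, abs_div, hx2, hn2]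
        calc |T| * (|deriv (deriv Real.smoothTransition) s| / ((n : ℝ) + 1) ^ 2) * x.2 i ^ 2
            ≤ |T| * (M / ((n : ℝ) + 1) ^ 2) * (4 * ((n : ℝ) + 1)) := by
              gcongr
              exact hM2 s
          _ = 4 * M * |T| * (1 / ((n : ℝ) + 1)) := by field_simp
          _ ≤ 4 * M * |T| * 1 := by
              gcongr
              rw [div_le_one hn]
              linarith
          _ = 4 * M * |T| := mul_one _
      calc _ ≤ |-(deriv Real.smoothTransition s) / ((n : ℝ) + 1) * (T - x.2 i ^ 2)| +
            |T * (deriv (deriv Real.smoothTransition) s / ((n : ℝ) + 1) ^ 2) * x.2 i ^ 2| :=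
            abs_add_le _ _
        _ ≤ (M * |T| + 4 * M) + 4 * M * |T| := add_le_add h1 h2
        _ ≤ 2 * M + 5 * M * |T| + 4 * M := by nlinarith [abs_nonneg T]

/-- Eventually (in `n`, for fixed `x`) all cutoff derivatives vanish at `x`:
`∂_{p_i}χ_n(x) = 0` and `S_i χ_n(x) = 0`. [folklore] -/
theorem eventually_cutoff_derivs_eq_zero (ω₂ lam β γ : ℝ) (L : ℕ) (T : ℝ) (x : PhaseSpace L) :
    ∀ᶠ k : ℕ in atTop, ∀ i : Fin L,
      partialP i (fun y : PhaseSpace L => CUT⟦ω₂ ; lam ; β ; γ ; k ; y⟧) x = 0 ∧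
        OU⟦T ; i ; fun y : PhaseSpace L => CUT⟦ω₂ ; lam ; β ; γ ; k ; y⟧ ; x⟧ = 0 := by
  obtain ⟨N, hN⟩ := exists_nat_ge ((pinnedChain ω₂ lam β γ).hamiltonian L x)
  filter_upwards [eventually_ge_atTop N] with n hn i
  have hn' : (N : ℝ) ≤ n := by exact_mod_cast hn
  have hn0 : (0 : ℝ) < (n : ℝ) + 1 := by positivity
  have hlt : 1 < 2 - (pinnedChain ω₂ lam β γ).hamiltonian L x / ((n : ℝ) + 1) := by
    have : (pinnedChain ω₂ lam β γ).hamiltonian L x / ((n : ℝ) + 1) < 1 := by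
      rw [div_lt_one hn0]; linarith
    linarith
  rw [ou_cutoff, partialP_cutoff, deriv_smoothTransition_eq_zero (Or.inr hlt),
    deriv_deriv_smoothTransition_eq_zero (Or.inr hlt)]
  simp

end Cutoff

/-- Registered helper stub of this support file: the energy cutoffs have compact support. [folklore] -/
theorem helper_insertionCutoff : ∀ {ω₂ lam β : ℝ}, 0 < ω₂ → 0 ≤ lam → 0 ≤ β → ∀ (γ : ℝ) (L n : ℕ), HasCompactSupport fun x : PhaseSpace L => Real.smoothTransition (2 - (pinnedChain ω₂ lam β γ).hamiltonian L x / ((n : ℝ) + 1)) := by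
  intro ω₂ lam β hω hl hβ γ L n
  exact hasCompactSupport_cutoff hω hl hβ γ L n

end Summit.AtomisticToContinuum.FouriersLaw.Cruxes.SuperadditiveResistance.InsertionToolbox

end
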